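import Literature.AnabelianGeometry.SemiGraphs.OneVertexCuspsHypotheses
import HarnessLib

/-!
# Actions on the cusps of a one-vertex semi-graph: a `Q`-action on the cusp index `ι` acts on the
# underlying semi-graph `OneVertexCusps.semiGraph ι` by automorphisms ([SemiAnbd] §1 p. 11, Ex. 3.10 p. 44)

Mochizuki, *Semi-graphs of anabelioids*, Publ. RIMS **42** (2006) [SemiAnbd], §1 p. 11 (morphisms of
semi-graphs: maps of vertices, edges, branches compatible with the coincidence maps), Example 3.10 p. 44
(«semi-graphs of anabelioids `𝒢_i`, `𝒢^c_i` on which `Δ_i` acts faithfully» — the finite Galois group of a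
covering of a curve permuting the cusps = open edges of the special fibre) [cite: MochizukiSemiAnbd2006, Ex 3.10 p.44].

Sequel (abc-iut cell, layer L3, seat abc-iut-L3-t11 gen 6, step (B4-prelim) of the row «NV-hLG@cusped» /
«CUSP-ABS·NONDEGENERATE-NV») of `OneVertexCuspsHypotheses.lean`: the levelwise cusp–graph binder `hLG` of
`TemperedCuspidalAbsolutenessOfProCusps.lean` asks for group homomorphisms `Π^temp → Aut(𝔾^c_i)` into the
automorphisms of the UNDERLYING semi-graphs of the fibres and reads the cusps' inertia groups as stabilisers of
open edges.  For the one-vertex semi-graph with cusps indexed by `ι`: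

* `OneVertexCusps.permHom σ` — the automorphism of semi-graphs induced by a permutation `σ` of `ι` (identity on
  the vertex, `σ` on edges, `σ × id` on branches); `permAut : Equiv.Perm ι →* Aut (semiGraph ι)` — as a group
  homomorphism (`permAut_hom_edgeMap : (permAut σ).hom.edgeMap = σ`);
* `OneVertexCusps.actAut : Q →* Aut (semiGraph ι)` for any group `Q` acting on `ι`
  (`MulAction.toPermHom` then `permAut`), with `actAut_hom_edgeMap : (actAut q).hom.edgeMap e = q • e`, so that
  «`g` fixes the edge `e`» is literally «`g ∈ Stab(e)`» (`actAut_edgeMap_eq_iff`).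

Structure only; no statement of the paper is touched; no instance, no notation, no `Prop` fact is declared.
Nothing here bears on [IUTchIII] Cor. 3.12.
-/

namespace Literature.AnabelianGeometry.SemiGraphs

namespace OneVertexCusps

open CategoryTheory

universe u

variable {ι : Type u}

/-- The endomorphism of the one-vertex semi-graph with cusps `ι` induced by a self-map `f` of `ι` (on edges `f`,
on branches `f × id`, identity on the vertex). [cite: MochizukiSemiAnbd2006, §1 p.11] -/
def mapHom (f : ι → ι) : SemiGraph.Hom (semiGraph ι) (semiGraph ι) where
  vertexMap := id
  edgeMap := f
  branchMap b := (f b.1, b.2)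
  edgeOf_branchMap _ := rfl
  branchMap_injOn b₁ b₂ he h := by
    obtain ⟨k₁, c₁⟩ := b₁
    obtain ⟨k₂, c₂⟩ := b₂
    cases he
    have hc : c₁ = c₂ := congrArg Prod.snd h
    cases hc
    rfl
  abuts_branchMap b v h := by
    obtain ⟨k, c⟩ := b
    cases c
    · cases h
    · cases v; rfl

/-- **The automorphism of `semiGraph ι` induced by a permutation of the cusps.** [cite: MochizukiSemiAnbd2006, §1 p.11] -/
def permAut (σ : Equiv.Perm ι) : Aut (semiGraph ι) where
  hom := mapHom σ
  inv := mapHom σ.symm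
  hom_inv_id := by
    refine SemiGraph.hom_ext _ _ rfl ?_ ?_
    · funext e; exact σ.symm_apply_apply e
    · funext b; exact Prod.ext (σ.symm_apply_apply b.1) rfl
  inv_hom_id := by
    refine SemiGraph.hom_ext _ _ rfl ?_ ?_
    · funext e; exact σ.apply_symm_apply e
    · funext b; exact Prod.ext (σ.apply_symm_apply b.1) rfl

/-- `permAut σ` acts on edges by `σ`. [cite: MochizukiSemiAnbd2006, §1 p.11] -/
@[simp] theorem permAut_hom_edgeMap (σ : Equiv.Perm ι) (e : (semiGraph ι).Edge) :
    (permAut σ).hom.edgeMap e = σ e := rfl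

/-- `permAut σ` acts on branches by `σ × id`. [cite: MochizukiSemiAnbd2006, §1 p.11] -/
@[simp] theorem permAut_hom_branchMap (σ : Equiv.Perm ι) (b : (semiGraph ι).Branch) :
    (permAut σ).hom.branchMap b = (σ b.1, b.2) := rfl

/-- `permAut σ` fixes the vertex. [cite: MochizukiSemiAnbd2006, §1 p.11] -/
@[simp] theorem permAut_hom_vertexMap (σ : Equiv.Perm ι) (v : (semiGraph ι).Vertex) :
    (permAut σ).hom.vertexMap v = v := rfl

variable (ι) in
/-- **`permAut` is a group homomorphism `Perm ι → Aut(semiGraph ι)`** (the group law of `Aut` being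
`(f * g).hom = g.hom ≫ f.hom`). [cite: MochizukiSemiAnbd2006, §1 p.11] -/
def permAutHom : Equiv.Perm ι →* Aut (semiGraph ι) where
  toFun := permAut
  map_one' := by
    refine Aut.ext (SemiGraph.hom_ext _ _ rfl ?_ ?_)
    · funext e; rfl
    · funext b; rfl
  map_mul' σ τ := by
    refine Aut.ext (SemiGraph.hom_ext _ _ rfl ?_ ?_)
    · funext e; rfl
    · funext b; rfl

/-- `permAutHom` is `permAut`. [cite: MochizukiSemiAnbd2006, §1 p.11] -/
@[simp] theorem permAutHom_apply (σ : Equiv.Perm ι) : permAutHom ι σ = permAut σ := rfl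

/-- **A `Q`-action on the cusps acts on the semi-graph**: `Q → Perm ι → Aut(semiGraph ι)` (Example 3.10: the
Galois group `Δ_i` of a covering acting on the special-fibre semi-graph `𝒢^c_i`, whose open edges are the cusps).
[cite: MochizukiSemiAnbd2006, Ex 3.10 p.44] -/
def actAut (Q : Type*) [Group Q] [MulAction Q ι] : Q →* Aut (semiGraph ι) :=
  (permAutHom ι).comp (MulAction.toPermHom Q ι)

/-- The action on edges is the given action on `ι`. [cite: MochizukiSemiAnbd2006, Ex 3.10 p.44] -/
@[simp] theorem actAut_hom_edgeMap (Q : Type*) [Group Q] [MulAction Q ι] (q : Q) (e : (semiGraph ι).Edge) :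
    (actAut Q q).hom.edgeMap e = q • e := rfl

/-- «`q` fixes the open edge `e`» is «`q` lies in the stabiliser of `e`». [cite: MochizukiSemiAnbd2006, Ex 3.10 p.44] -/
theorem actAut_edgeMap_eq_iff (Q : Type*) [Group Q] [MulAction Q ι] (q : Q) (e : (semiGraph ι).Edge) :
    (actAut Q q).hom.edgeMap e = e ↔ q ∈ MulAction.stabilizer Q e := by
  rw [actAut_hom_edgeMap, MulAction.mem_stabilizer_iff]

/-- Composite actions: a homomorphism `Π → Q` followed by `actAut Q` acts on edges through `Q`.
[cite: MochizukiSemiAnbd2006, Ex 3.10 p.44] -/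
theorem actAut_comp_edgeMap_eq_iff {G₀ : Type*} [Group G₀] (Q : Type*) [Group Q] [MulAction Q ι]
    (f : G₀ →* Q) (g : G₀) (e : (semiGraph ι).Edge) :
    (((actAut Q).comp f) g).hom.edgeMap e = e ↔ f g ∈ MulAction.stabilizer Q e :=
  actAut_edgeMap_eq_iff Q (f g) e

end OneVertexCusps

end Literature.AnabelianGeometry.SemiGraphs
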